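import Mathlib
import HarnessLib
import Literature.Analysis.FluidPDE.VectorCalculus
import Literature.Analysis.FluidPDE.VorticityCalculus
import Summits.NavierStokesRegularity.NavierStokesRegularity.Theorems.UnthreadedRigidityDoorUnthreadedRigidityVirialHornShellFields
import Summits.NavierStokesRegularity.NavierStokesRegularity.Theorems.UnthreadedRigidityDoorUnthreadedRigidityVirialHornShellDecay
import Summits.NavierStokesRegularity.NavierStokesRegularity.Theorems.UnthreadedRigidityDoorUnthreadedRigidityVirialHornOrderTwoLaw
import Summits.NavierStokesRegularity.NavierStokesRegularity.Theorems.UnthreadedRigidityDoorUnthreadedRigidityCoZonalDefs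

/-!
# W2 door `UnthreadedRigidity` — LINE g12-1 «CO-ZONAL»: O1₂ `TwoShellSliceOrderOneIdentity`

engine-1 g71 (KEY-NS #205 (a)).  THE TWO-SHELL FIRST JET: for virial-admissible profiles `H₁, H₂` and solid harmonics
`Y₁, Y₂` of degrees `l₁, l₂ ≥ 1`, the formal first threading jet of the two-shell slice
`u₀ = curl curl (H₁Y₁ y) + curl curl (H₂Y₂ y)` about `x₀` is

  `fluxJetOne u₀ x₀ (x₀ + y) = Λ(|y|)·{Y₁,Y₂}(y)`,  `Λ = l₂(l₂+1) H₂ K₁ − l₁(l₁+1) H₁ K₂`,  `Kᵢ = vortAmpL lᵢ Hᵢ`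

(`{Y₁,Y₂} = det[y,∇Y₁,∇Y₂]` = `VirialHorn.pbr`).  Ingredients, all by name from ns-crc-p2 g8's `…VirialHornShellFields` /
`…ShellCalculus` and the Literature vector calculus: the explicit shell `curl curl((h(|y|²)Y) y) = a∇Y − bY y`, its TOROIDAL
VORTICITY `curl u₀ = −K (∇Y × y)` with the amplitude identified BY NAME as `K = vortAmpL l H` (§1, via crc-p2's `vortAmpL_eq_of_sq`), the ORDER-ONE JET
of any smooth divergence-free field with tangential vorticity whose `curl curl ω` is tangential, `⟪curl(ΔP − (P·∇)P), y⟫ = D⟪P,y⟫[ω]`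
(§2, the abstract form of crc-p2's `inner_curl_fluxOne_shell_eq_zero`), and the two-shell bookkeeping `⟪P,y⟫ = Σ lᵢ(lᵢ+1)hᵢYᵢ`,
`D(hᵢYᵢ)[ωⱼ] = hᵢ⟪∇Yᵢ, ωⱼ⟫`, `⟪∇Y₁, ∇Y₂ × y⟫ = {Y₁,Y₂}`, `⟪∇Y₂, ∇Y₁ × y⟫ = −{Y₁,Y₂}` (§3).

LABEL: support identity of a MODEL line (W2 door, item 27585 OPEN); vector calculus of explicit fields; not a statement about
the Navier–Stokes equations.  0 kit.
-/

-- the summit and its single sub-problem share the name (CONVENTIONS §1), as in every Theorems file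
set_option linter.dupNamespace false

namespace Summit.NavierStokesRegularity.NavierStokesRegularity.Theorems.UnthreadedRigidity.CoZonal

open scoped Topology InnerProductSpace Laplacian
open Filter Set
open Literature.Analysis.FluidPDE
open Summit.NavierStokesRegularity.NavierStokesRegularity.Theorems.UnthreadedRigidity.VirialHorn
open Summit.NavierStokesRegularity.NavierStokesRegularity.Theorems.UnthreadedRigidity.ProfileHorn (E3)
open Summit.NavierStokesRegularity.NavierStokesRegularity.Theorems.UnthreadedRigidity.ThreadingJets (fluxJetOne)

/-! ## §1 The toroidal vorticity of a shell, with its amplitude by name -/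

/-- smoothness at `⊤ : ℕ∞` is preserved by `curl` (a private copy of a bookkeeping one-liner). -/
private theorem contDiff_top_curl {F : E3 → E3} (hF : ContDiff ℝ (⊤ : ℕ∞) F) : ContDiff ℝ (⊤ : ℕ∞) (curl F) :=
  contDiff_curl (n := ⊤) (by simpa using hF)

/-- THE VORTICITY OF A CENTRED SHELL, EXPLICITLY: `curl (curl curl ((h(|y|²)Y) y)) = −(4|y|²h″ + (4l+6)h′)(|y|²) (∇Y × y)`
(`h` smooth, `Y` a solid harmonic of degree `l`; the explicit form of crc-p2's `exists_curl_curl_curl_shell`). [folklore] -/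
theorem curl_curl_curl_shell_apply {h : ℝ → ℝ} (hh : ContDiff ℝ (⊤ : ℕ∞) h) {l : ℕ} {Y : E3 → ℝ}
    (hY : IsSolidHarmonic l Y) (y : E3) :
    curl (curl (curl (fun z : E3 => (h (‖z‖ ^ 2) * Y z) • z))) y =
      -((4 * ‖y‖ ^ 2 * deriv (deriv h) (‖y‖ ^ 2) + (4 * (l : ℝ) + 6) * deriv h (‖y‖ ^ 2)) • cross (gradient Y y) y) := by
  have hh' : ContDiff ℝ (⊤ : ℕ∞) (deriv h) := contDiff_deriv_of_contDiff_top hh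
  obtain ⟨a, ha_def⟩ : ∃ a : ℝ → ℝ, a = fun s => 2 * s * deriv h s + ((l : ℝ) + 1) * h s := ⟨_, rfl⟩
  obtain ⟨b, hb_def⟩ : ∃ b : ℝ → ℝ, b = fun s => 2 * (l : ℝ) * deriv h s := ⟨_, rfl⟩
  have ha : ContDiff ℝ (⊤ : ℕ∞) a := by
    rw [ha_def]; exact ((contDiff_const.mul contDiff_id).mul hh').add (contDiff_const.mul hh)
  have hb : ContDiff ℝ (⊤ : ℕ∞) b := by rw [hb_def]; exact contDiff_const.mul hh'
  have hshell : curl (curl (fun z : E3 => (h (‖z‖ ^ 2) * Y z) • z)) =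
      fun z : E3 => a (‖z‖ ^ 2) • gradient Y z - (b (‖z‖ ^ 2) * Y z) • z := by
    funext z
    rw [curl_curl_shell_apply (hh.of_le (by norm_cast)) hY z, ha_def, hb_def]
  rw [hshell, curl_explicitShell_apply (ha.of_le (by norm_cast)) (hb.of_le (by norm_cast)) hY y]
  -- `2a′ + b = 4sh″ + (4l+6)h′`
  have hhd : Differentiable ℝ h := hh.differentiable (by simp)
  have hh'd : Differentiable ℝ (deriv h) := hh'.differentiable (by simp)
  have hA : HasDerivAt a
      (2 * 1 * deriv h (‖y‖ ^ 2) + 2 * ‖y‖ ^ 2 * deriv (deriv h) (‖y‖ ^ 2) + ((l : ℝ) + 1) * deriv h (‖y‖ ^ 2))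
      (‖y‖ ^ 2) := by
    rw [ha_def]
    exact (((hasDerivAt_id (‖y‖ ^ 2)).const_mul 2).mul (hh'd (‖y‖ ^ 2)).hasDerivAt).add
      ((hhd (‖y‖ ^ 2)).hasDerivAt.const_mul _)
  rw [hA.deriv, hb_def]
  congr 2
  ring

/-- `∇Y(0) × 0 = 0`. -/
private theorem cross_zero_right (v : E3) : cross v (0 : E3) = 0 := by
  ext i
  fin_cases i <;> simp [cross]

/-- ★ THE VORTICITY OF THE SEPARABLE SHELL IS TOROIDAL WITH AMPLITUDE `K = vortAmpL l H`:
`curl (sepShellL H Y x₀) (x₀ + y) = −K(|y|) (∇Y(y) × y) = K(|y|) (y × ∇Y(y))` for a virial-admissible profile and a solid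
harmonic of degree `l`. [folklore] -/
theorem curl_sepShellL_apply_add {l : ℕ} {H : ℝ → ℝ} (hH : VirialAdmissible l H) {Y : E3 → ℝ} (hY : IsSolidHarmonic l Y)
    (x₀ y : E3) :
    curl (sepShellL H Y x₀) (x₀ + y) = -(vortAmpL l H ‖y‖ • cross (gradient Y y) y) := by
  obtain ⟨h, hh, hHh⟩ := hH.1
  rw [sepShellL_eq_comp_sub hHh Y x₀, curl_comp_sub_const_fun]
  simp only [add_sub_cancel_left]
  rw [curl_curl_curl_shell_apply hh hY y]
  by_cases hy : y = 0
  · subst hy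
    simp only [cross_zero_right, smul_zero]
  · rw [vortAmpL_eq_of_sq l hh hHh (norm_pos_iff.2 hy)]

/-! ## §2 The order-one jet of a field with tangential vorticity -/

/-- ORDER-ONE JET, ABSTRACT FORM: for a smooth divergence-free field `P` on `ℝ³` whose vorticity `ω = curl P` is tangential
to spheres (`⟪ω(z), z⟫ = 0`) and whose `curl curl ω` is tangential too, the radial component of `curl (ΔP − (P·∇)P)` is the
derivative of the radial moment `m(z) = ⟪P(z), z⟫` along the vorticity: `⟪curl(ΔP − (P·∇)P)(y), y⟫ = Dm(y)[ω(y)]`.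
(`ΔP = −curl ω`; Lamb form `(P·∇)P = ω × P + ∇|P|²/2`; `curl(ω × P) = Dω P − DP ω` for divergence-free `ω, P`;
`⟪Dω(y)v, y⟫ = −⟪ω(y), v⟫` by tangency.)  The abstract form of ns-crc-p2 g8's `inner_curl_fluxOne_shell_eq_zero`.
[cite: MajdaBertozziCUP2002, §1.1, §2.1] -/
theorem inner_curl_fluxOne_eq_fderiv_moment {P : E3 → E3} (hP : ContDiff ℝ (⊤ : ℕ∞) P)
    (hdiv : VectorCalculus.IsDivFree P) (htan : ∀ z : E3, inner ℝ (curl P z) z = 0)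
    (hcc : ∀ z : E3, inner ℝ (curl (curl (curl P)) z) z = 0) (y : E3) :
    inner ℝ (curl (fun z : E3 => (Δ P) z - convect P P z) y) y =
      fderiv ℝ (fun z : E3 => inner ℝ (P z) z) y (curl P y) := by
  obtain ⟨ω, hω_def⟩ : ∃ ω : E3 → E3, ω = curl P := ⟨_, rfl⟩
  -- regularity
  have hP2 : ContDiff ℝ 2 P := hP.of_le (by norm_cast)
  have hPd : Differentiable ℝ P := hP.differentiable (by simp)
  have hωs : ContDiff ℝ (⊤ : ℕ∞) ω := by rw [hω_def]; exact contDiff_top_curl hP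
  have hωd : Differentiable ℝ ω := hωs.differentiable (by simp)
  have hcωd : Differentiable ℝ (curl ω) := (contDiff_top_curl hωs).differentiable (by simp)
  -- `ΔP = −curl ω` and the Lamb form
  have hlap : (fun z : E3 => (Δ P) z) = fun z => -curl ω z := by
    funext z
    rw [hω_def, curl_curl_eq_neg_laplacian hP2 hdiv z, neg_neg]
  obtain ⟨q, hq_def⟩ : ∃ q : E3 → ℝ, q = fun z => ‖P z‖ ^ 2 / 2 := ⟨_, rfl⟩
  have hq : ContDiff ℝ 2 q := by
    have : ContDiff ℝ 2 (fun z : E3 => ‖P z‖ ^ 2) := hP2.norm_sq ℝ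
    rw [hq_def]
    exact this.div_const 2
  have hlamb : (fun z : E3 => convect P P z) = fun z => cross (ω z) (P z) + gradient q z := by
    funext z
    rw [hω_def, hq_def]
    exact convect_self_eq_cross_curl_add_gradient (hPd z)
  have hinner : (fun z : E3 => (Δ P) z - convect P P z) = fun z => -curl ω z - (cross (ω z) (P z) + gradient q z) := by
    funext z
    have e1 := congrFun hlap z
    have e2 := congrFun hlamb z
    rw [e1, e2]
  -- differentiability of the three pieces
  have hgq : Differentiable ℝ (gradient q) := by
    have h1 : ContDiff ℝ 1 (fderiv ℝ q) := hq.fderiv_right (m := 1) (by norm_cast)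
    exact (InnerProductSpace.toDual ℝ E3).symm.differentiable.comp (h1.differentiable (by simp))
  have hcrossd : Differentiable ℝ (fun z : E3 => cross (ω z) (P z)) := fun z =>
    (hasFDerivAt_cross (hωd z).hasFDerivAt (hPd z).hasFDerivAt).differentiableAt
  have hneg : DifferentiableAt ℝ (fun z : E3 => -curl ω z) y := (hcωd y).neg
  have hadd : DifferentiableAt ℝ (fun z : E3 => cross (ω z) (P z) + gradient q z) y := (hcrossd y).add (hgq y)
  have hcurl_split : curl (fun z : E3 => -curl ω z - (cross (ω z) (P z) + gradient q z)) y =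
      -curl (curl ω) y - (curl (fun z : E3 => cross (ω z) (P z)) y + curl (gradient q) y) := by
    rw [curl_sub hneg hadd, curl_neg, curl_add (hcrossd y) (hgq y)]
  have hcc' : inner ℝ (curl (curl ω) y) y = 0 := by rw [hω_def]; exact hcc y
  rw [hinner, hcurl_split, curl_gradient_eq_zero_holds q hq y, add_zero, inner_sub_left, inner_neg_left, hcc',
    neg_zero, zero_sub]
  -- `⟪curl (ω × P) y, y⟫ = −Dm(y)[ω y]`
  have htan' : ∀ z : E3, inner ℝ (ω z) z = 0 := by rw [hω_def]; exact htan
  have hdivω : VectorCalculus.divergence ω y = 0 := by rw [hω_def]; exact divergence_curl_eq_zero_holds P hP2 y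
  rw [curl_cross_apply (hωd y) (hPd y), hdivω, hdiv y, zero_smul, zero_smul, sub_zero, add_zero, inner_sub_left,
    inner_fderiv_of_tangent (hωd y) htan']
  have hmd : HasFDerivAt (fun z : E3 => inner ℝ (P z) z)
      ((fderivInnerCLM ℝ (P y, y)).comp ((fderiv ℝ P y).prod (ContinuousLinearMap.id ℝ E3))) y :=
    (hPd y).hasFDerivAt.inner ℝ (hasFDerivAt_id y)
  rw [← hω_def, hmd.fderiv]
  simp only [ContinuousLinearMap.comp_apply, ContinuousLinearMap.prod_apply, ContinuousLinearMap.id_apply,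
    fderivInnerCLM_apply]
  rw [real_inner_comm (P y) (ω y)]
  ring

/-! ## §3 Two shells -/

/-- components of the cross product. -/
private theorem cross_apply_zero (u v : E3) : cross u v 0 = u 1 * v 2 - u 2 * v 1 := by simp [cross, cross_apply]
/-- components of the cross product. -/
private theorem cross_apply_one (u v : E3) : cross u v 1 = u 2 * v 0 - u 0 * v 2 := by simp [cross, cross_apply]
/-- components of the cross product. -/
private theorem cross_apply_two (u v : E3) : cross u v 2 = u 0 * v 1 - u 1 * v 0 := by simp [cross, cross_apply]
/-- the inner product in coordinates. -/
private theorem real_inner_e3 (u v : E3) : ⟪u, v⟫_ℝ = u 0 * v 0 + u 1 * v 1 + u 2 * v 2 := by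
  simp [PiLp.inner_apply, Fin.sum_univ_three, mul_comm]

/-- `⟪∇Y₁, ∇Y₂ × y⟫ = det[y,∇Y₁,∇Y₂] = {Y₁,Y₂}(y)`. -/
private theorem inner_gradient_cross_eq_pbr (Y₁ Y₂ : E3 → ℝ) (y : E3) :
    ⟪gradient Y₁ y, cross (gradient Y₂ y) y⟫_ℝ = pbr Y₁ Y₂ y := by
  rw [pbr, det3, real_inner_e3, cross_apply_zero, cross_apply_one, cross_apply_two]; ring

/-- `⟪∇Y₂, ∇Y₁ × y⟫ = −{Y₁,Y₂}(y)`. -/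
private theorem inner_gradient_cross_eq_neg_pbr (Y₁ Y₂ : E3 → ℝ) (y : E3) :
    ⟪gradient Y₂ y, cross (gradient Y₁ y) y⟫_ℝ = -pbr Y₁ Y₂ y := by
  rw [pbr, det3, real_inner_e3, cross_apply_zero, cross_apply_one, cross_apply_two]; ring

/-- smoothness of the vorticity amplitude `s ↦ 4sh″(s) + (4l+6)h′(s)` of a smooth profile. -/
private theorem contDiff_vortProfile {h : ℝ → ℝ} (hh : ContDiff ℝ (⊤ : ℕ∞) h) (l : ℕ) :
    ContDiff ℝ (⊤ : ℕ∞) (fun s : ℝ => 4 * s * deriv (deriv h) s + (4 * (l : ℝ) + 6) * deriv h s) := by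
  have hh' : ContDiff ℝ (⊤ : ℕ∞) (deriv h) := contDiff_deriv_of_contDiff_top hh
  have hh'' : ContDiff ℝ (⊤ : ℕ∞) (deriv (deriv h)) := contDiff_deriv_of_contDiff_top hh'
  exact ((contDiff_const.mul contDiff_id).mul hh'').add (contDiff_const.mul hh')

/-- THE CENTRED TWO-SHELL FIRST JET: for smooth profiles `h₁, h₂`, solid harmonics `Y₁, Y₂` of degrees `l₁, l₂ ≥ 1` and
`P = curl curl((h₁Y₁) y) + curl curl((h₂Y₂) y)`,
`⟪curl(ΔP − (P·∇)P)(y), y⟫ = (l₂(l₂+1) h₂ c₁ − l₁(l₁+1) h₁ c₂)(|y|²) · {Y₁,Y₂}(y)`, `cᵢ(s) = 4shᵢ″ + (4lᵢ+6)hᵢ′`.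
(§2 with `ω = −c₁ ∇Y₁ × y − c₂ ∇Y₂ × y`, `⟪P,y⟫ = Σ lᵢ(lᵢ+1)hᵢYᵢ`; the self-terms drop out: `ωᵢ ⊥ ∇Yᵢ, y`.)
[cite: MajdaBertozziCUP2002, §1.1, §2.1] -/
theorem inner_curl_fluxOne_twoShell {l₁ l₂ : ℕ} (hl₁ : 1 ≤ l₁) (hl₂ : 1 ≤ l₂) {Y₁ Y₂ : E3 → ℝ}
    (hY₁ : IsSolidHarmonic l₁ Y₁) (hY₂ : IsSolidHarmonic l₂ Y₂) {h₁ h₂ : ℝ → ℝ}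
    (hh₁ : ContDiff ℝ (⊤ : ℕ∞) h₁) (hh₂ : ContDiff ℝ (⊤ : ℕ∞) h₂) {P : E3 → E3}
    (hPe : P = fun z : E3 => curl (curl (fun z : E3 => (h₁ (‖z‖ ^ 2) * Y₁ z) • z)) z
      + curl (curl (fun z : E3 => (h₂ (‖z‖ ^ 2) * Y₂ z) • z)) z) (y : E3) :
    inner ℝ (curl (fun z : E3 => (Δ P) z - convect P P z) y) y =
      ((l₂ : ℝ) * ((l₂ : ℝ) + 1) * h₂ (‖y‖ ^ 2)
          * (4 * ‖y‖ ^ 2 * deriv (deriv h₁) (‖y‖ ^ 2) + (4 * (l₁ : ℝ) + 6) * deriv h₁ (‖y‖ ^ 2))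
        - (l₁ : ℝ) * ((l₁ : ℝ) + 1) * h₁ (‖y‖ ^ 2)
          * (4 * ‖y‖ ^ 2 * deriv (deriv h₂) (‖y‖ ^ 2) + (4 * (l₂ : ℝ) + 6) * deriv h₂ (‖y‖ ^ 2)))
        * pbr Y₁ Y₂ y := by
  -- names
  obtain ⟨S₁, hS₁⟩ : ∃ S : E3 → E3, S = fun z : E3 => (h₁ (‖z‖ ^ 2) * Y₁ z) • z := ⟨_, rfl⟩
  obtain ⟨S₂, hS₂⟩ : ∃ S : E3 → E3, S = fun z : E3 => (h₂ (‖z‖ ^ 2) * Y₂ z) • z := ⟨_, rfl⟩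
  obtain ⟨c₁, hc₁⟩ : ∃ c : ℝ → ℝ, c = fun s : ℝ => 4 * s * deriv (deriv h₁) s + (4 * (l₁ : ℝ) + 6) * deriv h₁ s :=
    ⟨_, rfl⟩
  obtain ⟨c₂, hc₂⟩ : ∃ c : ℝ → ℝ, c = fun s : ℝ => 4 * s * deriv (deriv h₂) s + (4 * (l₂ : ℝ) + 6) * deriv h₂ s :=
    ⟨_, rfl⟩
  have hc₁s : ContDiff ℝ (⊤ : ℕ∞) c₁ := by rw [hc₁]; exact contDiff_vortProfile hh₁ l₁
  have hc₂s : ContDiff ℝ (⊤ : ℕ∞) c₂ := by rw [hc₂]; exact contDiff_vortProfile hh₂ l₂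
  have hc₁d : Differentiable ℝ c₁ := hc₁s.differentiable (by simp)
  have hc₂d : Differentiable ℝ c₂ := hc₂s.differentiable (by simp)
  have hY₁d : Differentiable ℝ Y₁ := hY₁.contDiff.differentiable (by simp)
  have hY₂d : Differentiable ℝ Y₂ := hY₂.contDiff.differentiable (by simp)
  have hh₁d : Differentiable ℝ h₁ := hh₁.differentiable (by simp)
  have hh₂d : Differentiable ℝ h₂ := hh₂.differentiable (by simp)
  -- smoothness of the shells
  have hS₁s : ContDiff ℝ (⊤ : ℕ∞) S₁ := by rw [hS₁]; exact contDiff_shell hh₁ hY₁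
  have hS₂s : ContDiff ℝ (⊤ : ℕ∞) S₂ := by rw [hS₂]; exact contDiff_shell hh₂ hY₂
  have hP₁s : ContDiff ℝ (⊤ : ℕ∞) (curl (curl S₁)) := contDiff_top_curl (contDiff_top_curl hS₁s)
  have hP₂s : ContDiff ℝ (⊤ : ℕ∞) (curl (curl S₂)) := contDiff_top_curl (contDiff_top_curl hS₂s)
  have hP₁d : Differentiable ℝ (curl (curl S₁)) := hP₁s.differentiable (by simp)
  have hP₂d : Differentiable ℝ (curl (curl S₂)) := hP₂s.differentiable (by simp)
  have hPe' : P = fun z : E3 => curl (curl S₁) z + curl (curl S₂) z := by rw [hPe, hS₁, hS₂]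
  have hP : ContDiff ℝ (⊤ : ℕ∞) P := by rw [hPe']; exact hP₁s.add hP₂s
  -- `div P = 0`
  have hdiv : VectorCalculus.IsDivFree P := by
    intro z
    have h1 := divergence_curl_eq_zero_holds (curl S₁) ((contDiff_top_curl hS₁s).of_le (by norm_cast)) z
    have h2 := divergence_curl_eq_zero_holds (curl S₂) ((contDiff_top_curl hS₂s).of_le (by norm_cast)) z
    unfold VectorCalculus.divergence at h1 h2 ⊢
    rw [hPe', fderiv_fun_add (hP₁d z) (hP₂d z)]
    push_cast
    rw [map_add, h1, h2, add_zero]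
  -- the vorticity `ω = −c₁ ∇Y₁ × y − c₂ ∇Y₂ × y`
  have hω₁ : ∀ z : E3, curl (curl (curl S₁)) z = -(c₁ (‖z‖ ^ 2) • cross (gradient Y₁ z) z) := fun z => by
    rw [hS₁, curl_curl_curl_shell_apply hh₁ hY₁ z, hc₁]
  have hω₂ : ∀ z : E3, curl (curl (curl S₂)) z = -(c₂ (‖z‖ ^ 2) • cross (gradient Y₂ z) z) := fun z => by
    rw [hS₂, curl_curl_curl_shell_apply hh₂ hY₂ z, hc₂]
  have hcurlP : curl P = fun z : E3 =>
      -(c₁ (‖z‖ ^ 2) • cross (gradient Y₁ z) z) + -(c₂ (‖z‖ ^ 2) • cross (gradient Y₂ z) z) := by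
    funext z
    rw [hPe', curl_add (hP₁d z) (hP₂d z), hω₁ z, hω₂ z]
  have htan : ∀ z : E3, inner ℝ (curl P z) z = 0 := fun z => by
    rw [hcurlP]
    simp only [inner_add_left, inner_neg_left, real_inner_smul_left, inner_cross_self_right, mul_zero, neg_zero,
      add_zero]
  -- `curl curl ω` is tangential: `ωᵢ = −curl((cᵢ Yᵢ) y)` is (minus) the curl of a shell again
  obtain ⟨T₁, hT₁⟩ : ∃ T : E3 → E3, T = fun z : E3 => (c₁ (‖z‖ ^ 2) * Y₁ z) • z := ⟨_, rfl⟩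
  obtain ⟨T₂, hT₂⟩ : ∃ T : E3 → E3, T = fun z : E3 => (c₂ (‖z‖ ^ 2) * Y₂ z) • z := ⟨_, rfl⟩
  have hT₁s : ContDiff ℝ (⊤ : ℕ∞) T₁ := by rw [hT₁]; exact contDiff_shell hc₁s hY₁
  have hT₂s : ContDiff ℝ (⊤ : ℕ∞) T₂ := by rw [hT₂]; exact contDiff_shell hc₂s hY₂
  have hcT₁d : Differentiable ℝ (curl T₁) := (contDiff_top_curl hT₁s).differentiable (by simp)
  have hcT₂d : Differentiable ℝ (curl T₂) := (contDiff_top_curl hT₂s).differentiable (by simp)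
  have hccT₁d : Differentiable ℝ (curl (curl T₁)) :=
    (contDiff_top_curl (contDiff_top_curl hT₁s)).differentiable (by simp)
  have hccT₂d : Differentiable ℝ (curl (curl T₂)) :=
    (contDiff_top_curl (contDiff_top_curl hT₂s)).differentiable (by simp)
  have hcurlP' : curl P = fun z : E3 => -curl T₁ z + -curl T₂ z := by
    rw [hcurlP, hT₁, hT₂, curl_shell_eq hc₁d hY₁d, curl_shell_eq hc₂d hY₂d]
  have hn₁ : ∀ z : E3, DifferentiableAt ℝ (fun w : E3 => -curl T₁ w) z := fun z => (hcT₁d z).neg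
  have hn₂ : ∀ z : E3, DifferentiableAt ℝ (fun w : E3 => -curl T₂ w) z := fun z => (hcT₂d z).neg
  have hcurl2 : curl (curl P) = fun z : E3 => -curl (curl T₁) z + -curl (curl T₂) z := by
    funext z
    rw [hcurlP', curl_add (hn₁ z) (hn₂ z), curl_neg, curl_neg]
  have hnn₁ : ∀ z : E3, DifferentiableAt ℝ (fun w : E3 => -curl (curl T₁) w) z := fun z => (hccT₁d z).neg
  have hnn₂ : ∀ z : E3, DifferentiableAt ℝ (fun w : E3 => -curl (curl T₂) w) z := fun z => (hccT₂d z).neg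
  have hcc : ∀ z : E3, inner ℝ (curl (curl (curl P)) z) z = 0 := fun z => by
    rw [hcurl2, curl_add (hnn₁ z) (hnn₂ z), curl_neg, curl_neg, hT₁, hT₂,
      curl_curl_curl_shell_apply hc₁s hY₁ z, curl_curl_curl_shell_apply hc₂s hY₂ z]
    simp only [neg_neg, inner_add_left, real_inner_smul_left, inner_cross_self_right, mul_zero, add_zero]
  -- §2
  rw [inner_curl_fluxOne_eq_fderiv_moment hP hdiv htan hcc y]
  -- the radial moment `m(z) = ⟪P z, z⟫ = l₁(l₁+1) h₁Y₁ + l₂(l₂+1) h₂Y₂` and its derivative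
  have hm : (fun z : E3 => inner ℝ (P z) z) = fun z =>
      ((l₁ : ℝ) * ((l₁ : ℝ) + 1)) * (h₁ (‖z‖ ^ 2) * Y₁ z) + ((l₂ : ℝ) * ((l₂ : ℝ) + 1)) * (h₂ (‖z‖ ^ 2) * Y₂ z) := by
    funext z
    rw [hPe']
    simp only [inner_add_left]
    rw [hS₁, hS₂, inner_curl_curl_shell_self (hh₁.of_le (by norm_cast)) hY₁ hl₁ z,
      inner_curl_curl_shell_self (hh₂.of_le (by norm_cast)) hY₂ hl₂ z]
  have hH₁ : HasFDerivAt (fun z : E3 => h₁ (‖z‖ ^ 2)) (deriv h₁ (‖y‖ ^ 2) • (2 • innerSL ℝ y)) y :=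
    ((hh₁d (‖y‖ ^ 2)).hasDerivAt).comp_hasFDerivAt y (hasStrictFDerivAt_norm_sq y).hasFDerivAt
  have hH₂ : HasFDerivAt (fun z : E3 => h₂ (‖z‖ ^ 2)) (deriv h₂ (‖y‖ ^ 2) • (2 • innerSL ℝ y)) y :=
    ((hh₂d (‖y‖ ^ 2)).hasDerivAt).comp_hasFDerivAt y (hasStrictFDerivAt_norm_sq y).hasFDerivAt
  have hprod₁ : HasFDerivAt (fun z : E3 => h₁ (‖z‖ ^ 2) * Y₁ z)
      (h₁ (‖y‖ ^ 2) • fderiv ℝ Y₁ y + Y₁ y • (deriv h₁ (‖y‖ ^ 2) • (2 • innerSL ℝ y))) y :=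
    hH₁.mul (hY₁d y).hasFDerivAt
  have hprod₂ : HasFDerivAt (fun z : E3 => h₂ (‖z‖ ^ 2) * Y₂ z)
      (h₂ (‖y‖ ^ 2) • fderiv ℝ Y₂ y + Y₂ y • (deriv h₂ (‖y‖ ^ 2) • (2 • innerSL ℝ y))) y :=
    hH₂.mul (hY₂d y).hasFDerivAt
  have hm' : HasFDerivAt (fun z : E3 => inner ℝ (P z) z)
      (((l₁ : ℝ) * ((l₁ : ℝ) + 1)) • (h₁ (‖y‖ ^ 2) • fderiv ℝ Y₁ y + Y₁ y • (deriv h₁ (‖y‖ ^ 2) • (2 • innerSL ℝ y)))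
        + ((l₂ : ℝ) * ((l₂ : ℝ) + 1)) • (h₂ (‖y‖ ^ 2) • fderiv ℝ Y₂ y + Y₂ y • (deriv h₂ (‖y‖ ^ 2) • (2 • innerSL ℝ y))))
      y := by
    rw [hm]
    exact (hprod₁.const_mul _).add (hprod₂.const_mul _)
  rw [hm'.fderiv]
  -- evaluation at `ω y`: the radial parts vanish, `DYᵢ[ω] = ⟪∇Yᵢ, ω⟫`
  have hy0 : inner ℝ y (curl P y) = 0 := by rw [real_inner_comm]; exact htan y
  have hg₁ : fderiv ℝ Y₁ y (curl P y) = -(c₂ (‖y‖ ^ 2) * pbr Y₁ Y₂ y) := by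
    have e : fderiv ℝ Y₁ y (curl P y) = inner ℝ (gradient Y₁ y) (curl P y) := by
      rw [gradient, InnerProductSpace.toDual_symm_apply]
    rw [e, hcurlP]
    simp only [inner_add_right, inner_neg_right, real_inner_smul_right]
    rw [← real_inner_comm (gradient Y₁ y) (cross (gradient Y₁ y) y), inner_cross_self_left,
      inner_gradient_cross_eq_pbr]
    ring
  have hg₂ : fderiv ℝ Y₂ y (curl P y) = c₁ (‖y‖ ^ 2) * pbr Y₁ Y₂ y := by
    have e : fderiv ℝ Y₂ y (curl P y) = inner ℝ (gradient Y₂ y) (curl P y) := by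
      rw [gradient, InnerProductSpace.toDual_symm_apply]
    rw [e, hcurlP]
    simp only [inner_add_right, inner_neg_right, real_inner_smul_right]
    rw [← real_inner_comm (gradient Y₂ y) (cross (gradient Y₂ y) y), inner_cross_self_left,
      inner_gradient_cross_eq_neg_pbr]
    ring
  simp only [add_apply, smul_apply, innerSL_apply_apply, hy0, smul_zero, smul_eq_mul, mul_zero, add_zero, hg₁, hg₂,
    hc₁, hc₂]
  ring

/-! ## §4 O1₂ by name -/

/-- ★ O1₂ «TWO-SHELL FIRST JET» (`TwoShellSliceOrderOneIdentity`, LINE g12-1 CO-ZONAL, ns-idea-6 `CoZonal_sketch`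
c7eabdeb25f1685c; the computation (F1) behind g11's linkage law): for virial-admissible `H₁, H₂` and solid harmonics `Y₁, Y₂` of
degrees `l₁, l₂ ≥ 1`, `fluxJetOne (twoShellL H₁ H₂ Y₁ Y₂ x₀) x₀ (x₀ + y) = Λ(|y|)·{Y₁,Y₂}(y)` for `y ≠ 0`, with the LINK AMPLITUDE
`Λ = linkAmp l₁ l₂ H₁ H₂ = l₂(l₂+1)H₂K₁ − l₁(l₁+1)H₁K₂`, `Kᵢ = vortAmpL lᵢ Hᵢ`.  (§3 translated to `x₀`, and `Kᵢ(|y|) = cᵢ(|y|²)`,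
`Hᵢ(|y|) = hᵢ(|y|²)` by `vortAmpL_eq_of_sq`.) -/
theorem twoShellSliceOrderOneIdentity_holds : TwoShellSliceOrderOneIdentity := by
  intro l₁ l₂ H₁ H₂ Y₁ Y₂ x₀ hl₁ hl₂ hY₁ hY₂ hH₁ hH₂ y hy
  obtain ⟨h₁, hh₁, hHh₁⟩ := hH₁.1
  obtain ⟨h₂, hh₂, hHh₂⟩ := hH₂.1
  obtain ⟨P, hPe⟩ : ∃ P : E3 → E3, P = fun z : E3 => curl (curl (fun z : E3 => (h₁ (‖z‖ ^ 2) * Y₁ z) • z)) z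
      + curl (curl (fun z : E3 => (h₂ (‖z‖ ^ 2) * Y₂ z) • z)) z := ⟨_, rfl⟩
  -- the two-shell slice about `x₀` is the translate of `P`
  have hv : twoShellL H₁ H₂ Y₁ Y₂ x₀ = fun x : E3 => P (x - x₀) := by
    funext x
    simp only [twoShellL]
    rw [sepShellL_eq_comp_sub hHh₁ Y₁ x₀, sepShellL_eq_comp_sub hHh₂ Y₂ x₀, hPe]
  -- the jet about `x₀` is the centred jet at `x − x₀`
  have hin1 : ∀ z : E3, (Δ (twoShellL H₁ H₂ Y₁ Y₂ x₀)) z = (Δ P) (z - x₀) := fun z => by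
    rw [hv]; exact laplacian_comp_sub_const P x₀ z
  have hin2 : ∀ z : E3, convect (twoShellL H₁ H₂ Y₁ Y₂ x₀) (twoShellL H₁ H₂ Y₁ Y₂ x₀) z = convect P P (z - x₀) := by
    intro z
    rw [convect_apply, convect_apply, hv, fderiv_comp_sub]
  obtain ⟨G, hG⟩ : ∃ G : E3 → E3, G = fun w : E3 => (Δ P) w - convect P P w := ⟨_, rfl⟩
  have hin : (fun z : E3 => (Δ (twoShellL H₁ H₂ Y₁ Y₂ x₀)) z
      - convect (twoShellL H₁ H₂ Y₁ Y₂ x₀) (twoShellL H₁ H₂ Y₁ Y₂ x₀) z) = fun z : E3 => G (z - x₀) := by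
    funext z
    rw [hin1 z, hin2 z, hG]
  unfold ThreadingJets.fluxJetOne
  rw [hin, curl_comp_sub_const_fun G x₀]
  simp only [add_sub_cancel_left]
  rw [hG, inner_curl_fluxOne_twoShell hl₁ hl₂ hY₁ hY₂ hh₁ hh₂ hPe y]
  -- `Kᵢ(|y|) = cᵢ(|y|²)`, `Hᵢ(|y|) = hᵢ(|y|²)`
  have hr : 0 < ‖y‖ := norm_pos_iff.2 hy
  unfold linkAmp
  rw [vortAmpL_eq_of_sq l₁ hh₁ hHh₁ hr, vortAmpL_eq_of_sq l₂ hh₂ hHh₂ hr, hHh₁ ‖y‖ hr.le,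
    hHh₂ ‖y‖ hr.le]

end Summit.NavierStokesRegularity.NavierStokesRegularity.Theorems.UnthreadedRigidity.CoZonal
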